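import Summits.PneNP.PneNP.Theorems.RegularResolutionRung.Negative.OneSidedFalse

/-!
# Line `sound-path-bottleneck` — checked skeleton for the crux
`RamseyUncertifiable.RegularResolutionRung` (stmt-PneNP-9818, route `RamseyUncertifiable`), crux-plan round 1

Crux (fixed, by name): `∃ ε > 0 ∃ n₀ ∀ n ≥ n₀ ∀ G ∀ π₁ π₂`, regular refutations `π₁` of the unary
`Clique(G, ⌈2log₂ n⌉)` and `π₂` of `Clique(Ḡ, ⌈2log₂ n⌉)` have `n^{ε log₂ n} ≤ max |π₁| |π₂|`
(definitionally `Negative.Restated`, `regularResolutionRung_iff_restated : crux ↔ Restated := Iff.rfl`).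

LINE (idea card `Ideas/sound-path-bottleneck.md`, triage r1-1/2/3 pass). Put LPRT's dense-extension
Adversary INSIDE the random path of ABdRLNR's bottleneck count: on the DAG of a regular refutation of
`Clique(H,k)` a path answers a query `x_{i,v}` by `1` only through a `p₁`-coin AND only if `v` is
SOUND (keeps a `δ`-fraction of `N̂(U')` for every `≤ L₀`-subset `U'` of the vertices already
accepted); junk is answered `0` without a coin; a bottleneck pair `(a,b)` is judged good against the
ACCEPTED set only, and ABdRLNR's hitting set (property 2) is replaced by the spread weight of minimal
sound `W`-traps. The reduction is

  crux ⇐ (soundness, PROVED) + `RamseyBiDenseCore` (stub 1, Prömel–Rödl) + `RestrictToInduced`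
         (stub 2) + `BiDenseRegularLB` (= the card's transfer target C⁺, PROVED here from 3 + 4);
  C⁺   ⇐ `SoundPathCount` (stub 3: the bottleneck count under `D*`, a conditional theorem) +
         `BiDenseTrapSparse` (stub 4: bi-dense ⇒ sound-trap sparse at admissible parameters — THE BET).

`RegularResolutionRung_of` composes the four stubs into the crux BY NAME with a real proof
(`restated_of_line` = `restated_of_transfer`: threshold arithmetic `k = ⌈2log₂n⌉ ≤ 4log₂ m`, `(log₂ m)² ≥ (9/16)(log₂ n)²`
for the core size `m ≥ n^{3/4}`; `biDenseRegularLB_of`: `1 ≤ |π|²X`, `m^{2ε log₂ m}X ≤ 1`).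
Also PROVED: resolution soundness for the tree's `IsResRefutation` (`not_satisfiable_of_refutation`),
encoding faithfulness (`satisfiable_cliqueCNF_of_clique`, `cliqueFree_of_refutation`), and the two
bricks of the card — `junk_card_lt` (JunkSetSmall) and `commonNbhd_chain_lb` (SoundChainBound).

Disproof.lean honoured (cdisprove g2 cycle 1; Negative/OneSidedFalse imported):
`regularResolutionRung_false_without_complement` / `_false_without_graph` — the line USES `π₂`: in
`restated_of_transfer`, `cliqueFree_of_refutation Gᶜ hπ₂` certifies `α(G) < k`, without which stub 1
(Ramsey ⇒ bi-dense core) does not apply (for `G = ⊥`/`⊤` there is no bi-dense core and the stubs'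
bi-density hypotheses fail, so no stub is an instance the landed Negative lemmas refute); calibration
(b) `ε ≤ 2`: our `ε = 9ε₁/16` is existential and tiny; (d) planted dead-end cliques kill every
HITTING-SET form of property 2 — this line has no hitting set: traps are judged only against the
accepted set (`IsTrap.dense`) and counted with spread weight (`trapWeight`); (c)/(e): the statement is
proved from Ramsey-ness alone via the Prömel–Rödl core at polynomial scale, as (e) demands.
Vocabulary `cliqueCNF` is the Negative file's (verbatim the route's `let cnf`).
-/

set_option linter.dupNamespace false
set_option linter.unusedVariables false
set_option linter.unusedSectionVars false

noncomputable section

open scoped BigOperators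

namespace Summit.PneNP.PneNP.Cruxes.RegularResolutionRung.SoundPathBottleneck

open Finset
open Literature.Computability.MetaComplexity Literature.Computability.Complexity
open Summit.PneNP.PneNP.Theorems.RegularResolutionRung.Negative (cliqueCNF Restated
  regularResolutionRung_iff_restated digits_of)

/-! ## §0 Vocabulary -/

section Vocabulary

variable {m : ℕ}

/-- Ordered pair count `e(A,B) = #{(a,b) ∈ A × B : a ∼ b}` (LPRT Def. 10). [folklore] -/
def edgeCount (H : SimpleGraph (Fin m)) [DecidableRel H.Adj] (A B : Finset (Fin m)) : ℕ :=
  ((A ×ˢ B).filter fun p => H.Adj p.1 p.2).card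

/-- Lower bi-density at scale `M` with density `δ`: every pair of `M`-large vertex sets spans at
least a `δ`-fraction of the possible ordered pairs (the half of Prömel–Rödl used by LPRT). -/
def LowerBiDense (H : SimpleGraph (Fin m)) [DecidableRel H.Adj] (M : ℕ) (δ : ℝ) : Prop :=
  ∀ A B : Finset (Fin m), M ≤ A.card → M ≤ B.card → δ * A.card * B.card ≤ (edgeCount H A B : ℝ)

/-- Upper bi-density at scale `M` (the half of Prömel–Rödl NOT used by LPRT; it is what separates
Ramsey cores from complete `(k-1)`-partite graphs and from complete joins). -/
def UpperBiDense (H : SimpleGraph (Fin m)) [DecidableRel H.Adj] (M : ℕ) (δ : ℝ) : Prop :=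
  ∀ A B : Finset (Fin m), M ≤ A.card → M ≤ B.card → (edgeCount H A B : ℝ) ≤ (1 - δ) * A.card * B.card

/-- Common neighbourhood `N̂(U) = {v : ∀ u ∈ U, u ∼ v}` (all of `V` for `U = ∅`). -/
def commonNbhd (H : SimpleGraph (Fin m)) [DecidableRel H.Adj] (U : Finset (Fin m)) : Finset (Fin m) :=
  univ.filter fun v => ∀ u ∈ U, H.Adj u v

/-- `Q` is SOUNDLY ORDERABLE (w.r.t. `δ`, `L₀`): it can be listed so that every element keeps a
`δ`-fraction of the common neighbourhood of EVERY `≤ L₀`-subset of its predecessors — exactly the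
dense-extension test (LPRT Cor. 12) that the path distribution `D*` imposes on each accepted vertex,
so every subset of the accepted set of a `D*`-path is soundly orderable (in acceptance order). -/
def SoundlyOrderable (H : SimpleGraph (Fin m)) [DecidableRel H.Adj] (δ : ℝ) (L₀ : ℕ)
    (Q : Finset (Fin m)) : Prop :=
  ∃ l : List (Fin m), l.Nodup ∧ l.toFinset = Q ∧
    ∀ (j : ℕ) (hj : j < l.length), ∀ U ⊆ (l.take j).toFinset, U.card ≤ L₀ →
      δ * ((commonNbhd H U).card : ℝ) ≤ ((commonNbhd H (insert (l.get ⟨j, hj⟩) U)).card : ℝ)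

/-- `B` is a (minimal, sound) `W`-TRAP over the pinned set `T`: the data of Case 2a of the
bottleneck count. `B` is what the path accepts between the two bottleneck nodes (`|B| ≤ b`), `T` the
ones remembered at the first node; the trap closes (`< q'` common `W`-neighbours of `T ∪ B`) although
every `≤ r`-subset of `T ∪ B` is `q`-dense into `W` (the pair is `α`-good), `B` is inclusion-minimal
with the closing property, and `T ∪ B` is soundly orderable (it lies inside the accepted set). -/
structure IsTrap (H : SimpleGraph (Fin m)) [DecidableRel H.Adj] (δ : ℝ) (L₀ r b q q' : ℕ)
    (W T B : Finset (Fin m)) : Prop where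
  card_le : B.card ≤ b
  disjoint : Disjoint T B
  closes : (W ∩ commonNbhd H (T ∪ B)).card < q'
  dense : ∀ R ⊆ T ∪ B, R.card ≤ r → q ≤ (W ∩ commonNbhd H R).card
  minimal : ∀ B' ⊂ B, q' ≤ (W ∩ commonNbhd H (T ∪ B')).card
  sound : SoundlyOrderable H δ L₀ (T ∪ B)

open scoped Classical in
/-- The SPREAD WEIGHT of the `W`-traps over `T`: `Σ_{B trap} θ^{|B|}` (in the count, `θ = k·p₁`
bounds the probability that a fixed vertex is ever accepted by a `D*`-path). -/
def trapWeight (H : SimpleGraph (Fin m)) [DecidableRel H.Adj] (δ : ℝ) (L₀ r b q q' : ℕ) (θ : ℝ)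
    (W T : Finset (Fin m)) : ℝ :=
  ∑ B : Finset (Fin m), if IsTrap H δ L₀ r b q q' W T B then θ ^ B.card else 0

/-- SOUND-TRAP SPARSITY of `H` at the given parameters: for every vertex set `W` and every pinned
set `T` with `|T| ≤ r/2`, the spread weight of the `W`-traps over `T` is at most `τ`. This is the
property-2 substitute of the line (ABdRLNR Def. 6.2's hitting set replaced by a weighted count). -/
def SoundTrapSparseAt (H : SimpleGraph (Fin m)) [DecidableRel H.Adj] (δ : ℝ) (L₀ r b q q' : ℕ)
    (θ τ : ℝ) : Prop :=
  ∀ W T : Finset (Fin m), T.card ≤ r / 2 → trapWeight H δ L₀ r b q q' θ W T ≤ τ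

/-! ### §0b Proved bricks (the two "first lemmas" of the idea card; both feed stub 3) -/

/-- `e(A,B) = Σ_{a ∈ A} |N(a) ∩ B|`. -/
theorem edgeCount_eq_sum (H : SimpleGraph (Fin m)) [DecidableRel H.Adj] (A B : Finset (Fin m)) :
    edgeCount H A B = ∑ a ∈ A, (B.filter fun b => H.Adj a b).card := by
  unfold edgeCount
  rw [Finset.card_filter, Finset.sum_product]
  refine Finset.sum_congr rfl fun a _ => ?_
  rw [Finset.card_filter]

/-- **JunkSetSmall** (LPRT Lemma 11 ⇒ Cor. 12, p. 9): under lower bi-density at scale `M`, fewer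
than `M` vertices see less than a `δ`-fraction of an `M`-large set `Y`. In stub 3 this caps the
coin-free ("junk") zeros of a `D*`-path by `refCount k L₀ · M`. -/
theorem junk_card_lt (H : SimpleGraph (Fin m)) [DecidableRel H.Adj] {M : ℕ} {δ : ℝ}
    (hlo : LowerBiDense H M δ) (hM : 0 < M) (Y : Finset (Fin m)) (hY : M ≤ Y.card) :
    (univ.filter fun w => ((Y.filter fun y => H.Adj w y).card : ℝ) < δ * Y.card).card < M := by
  by_contra hJ
  push Not at hJ
  set J := univ.filter fun w => ((Y.filter fun y => H.Adj w y).card : ℝ) < δ * Y.card with hJdef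
  have h1 := hlo J Y hJ hY
  rw [edgeCount_eq_sum] at h1
  push_cast at h1
  have hne : J.Nonempty := Finset.card_pos.1 (lt_of_lt_of_le hM hJ)
  have h2 : ∑ a ∈ J, ((Y.filter fun b => H.Adj a b).card : ℝ) < ∑ a ∈ J, δ * Y.card :=
    Finset.sum_lt_sum_of_nonempty hne fun a ha => (Finset.mem_filter.1 ha).2
  rw [Finset.sum_const, nsmul_eq_mul] at h2
  have h3 : (J.card : ℝ) * (δ * Y.card) = δ * J.card * Y.card := by ring
  linarith

/-- `N̂(∅) = V`. -/
theorem commonNbhd_empty (H : SimpleGraph (Fin m)) [DecidableRel H.Adj] :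
    commonNbhd H ∅ = univ := by
  unfold commonNbhd
  exact Finset.filter_true_of_mem fun v _ => by simp

/-- `N̂(insert u U) = N(u) ∩ N̂(U)`. -/
theorem commonNbhd_insert (H : SimpleGraph (Fin m)) [DecidableRel H.Adj] (u : Fin m)
    (U : Finset (Fin m)) :
    commonNbhd H (insert u U) = (commonNbhd H U).filter fun v => H.Adj u v := by
  unfold commonNbhd
  ext v
  simp [Finset.mem_filter, and_comm]

/-- **SoundChainBound** (the soundness invariant of `D*`; deterministic half of Lemma 6.6): along a
list in which every element keeps a `δ`-fraction of the common neighbourhood of its predecessors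
(one instance of `SoundlyOrderable`'s test), the whole list has at least `δ^{length}·m` common
neighbours. With `length ≤ t·r ≤ L₀` this is the `|N̂(R)| ≥ δ^{tr} m` behind the goodness
threshold `t·q ≤ δ^{tr}·m` of stub 3. -/
theorem commonNbhd_chain_lb (H : SimpleGraph (Fin m)) [DecidableRel H.Adj] {δ : ℝ} (hδ : 0 ≤ δ) :
    ∀ l : List (Fin m),
      (∀ (j : ℕ) (hj : j < l.length),
        δ * ((commonNbhd H (l.take j).toFinset).card : ℝ) ≤
          ((commonNbhd H (insert (l.get ⟨j, hj⟩) (l.take j).toFinset)).card : ℝ)) →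
      δ ^ l.length * (m : ℝ) ≤ ((commonNbhd H l.toFinset).card : ℝ) := by
  intro l
  induction l using List.reverseRecOn with
  | nil =>
    intro _
    simp [commonNbhd_empty]
  | append_singleton l x ih =>
    intro hl
    have hlen : (l ++ [x]).length = l.length + 1 := by simp
    have hl' : ∀ (j : ℕ) (hj : j < l.length),
        δ * ((commonNbhd H (l.take j).toFinset).card : ℝ) ≤
          ((commonNbhd H (insert (l.get ⟨j, hj⟩) (l.take j).toFinset)).card : ℝ) := by
      intro j hj
      have hj' : j < (l ++ [x]).length := by rw [hlen]; omega
      have h := hl j hj'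
      have htake : (l ++ [x]).take j = l.take j := List.take_append_of_le_length hj.le
      have hget : (l ++ [x]).get ⟨j, hj'⟩ = l.get ⟨j, hj⟩ := by
        simp [List.getElem_append_left hj]
      rwa [htake, hget] at h
    have ih' := ih hl'
    have hlast := hl l.length (by rw [hlen]; omega)
    have htake : (l ++ [x]).take l.length = l := by simp
    have hget : (l ++ [x]).get ⟨l.length, by rw [hlen]; omega⟩ = x := by simp
    rw [htake, hget] at hlast
    have hfin : (l ++ [x]).toFinset = insert x l.toFinset := by
      ext v; simp
    rw [hfin, hlen, pow_succ]
    calc δ ^ l.length * δ * (m : ℝ) = δ * (δ ^ l.length * (m : ℝ)) := by ring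
      _ ≤ δ * ((commonNbhd H l.toFinset).card : ℝ) := mul_le_mul_of_nonneg_left ih' hδ
      _ ≤ _ := hlast

end Vocabulary

/-- Number of reference sets `U' ⊆ ACC`, `|U'| ≤ L₀`, of an accepted set of size `≤ k`:
`Σ_{l ≤ L₀} C(k,l)`; times the bi-density scale `M` it bounds the junk (coin-free) zeros of a path. -/
def refCount (k L₀ : ℕ) : ℕ :=
  ∑ l ∈ Finset.range (L₀ + 1), k.choose l

/-! ## §1 The statements of the line -/

/-- **Stub 1a — Erdős–Szemerédi 1972** ("On a Ramsey type theorem", Period. Math. Hungar. 2;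
Kwan–Sudakov arXiv:1711.02937 Lemma 2): for every `C` there is `ε > 0` such that every `C`-Ramsey graph
(no clique and no independent set of size `k ≤ C log₂ n`) on `n ≥ n₀` vertices has at least `ε n²` ordered
adjacent pairs. One-sided (lower) form; the upper bound is the same statement for `Gᶜ`. -/
def ErdosSzemerediLower : Prop :=
  ∀ C : ℝ, 0 < C → ∃ ε : ℝ, 0 < ε ∧ ∃ n₀ : ℕ, ∀ n ≥ n₀,
    ∀ (G : SimpleGraph (Fin n)) [DecidableRel G.Adj] (k : ℕ), (k : ℝ) ≤ C * Real.logb 2 n →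
      G.CliqueFree k → Gᶜ.CliqueFree k → ε * n * n ≤ (edgeCount G Finset.univ Finset.univ : ℝ)

/-- **Stub 1b — Prömel–Rödl bi-dense core** (PromelRodl1999; LPRT arXiv:1303.3166 Lemma 11, p. 9),
stated at the Erdős threshold and presented through an embedding: every graph on `n ≥ n₀` vertices
with neither a clique nor an independent set of size `⌈2 log₂ n⌉ = Nat.clog 2 (n²)` has an induced
subgraph on `m ≥ n^{3/4}` vertices that is two-sided `(β,δ)`-bi-dense at scale `⌈m^{1-β}⌉`. -/
def RamseyBiDenseCore : Prop :=
  ∃ β : ℝ, 0 < β ∧ β < 1 ∧ ∃ δ : ℝ, 0 < δ ∧ δ < 1 ∧ ∃ n₀ : ℕ, ∀ n ≥ n₀,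
    ∀ (G : SimpleGraph (Fin n)) [DecidableRel G.Adj],
      G.CliqueFree (Nat.clog 2 (n ^ 2)) → Gᶜ.CliqueFree (Nat.clog 2 (n ^ 2)) →
      ∃ m : ℕ, (n : ℝ) ^ (3 / 4 : ℝ) ≤ m ∧ ∃ e : Fin m ↪ Fin n,
        LowerBiDense (G.comap e) ⌈(m : ℝ) ^ (1 - β)⌉₊ δ ∧ UpperBiDense (G.comap e) ⌈(m : ℝ) ^ (1 - β)⌉₊ δ

/-- **Stub 2 — regular refutations restrict to induced subgraphs** (folklore restriction lemma,
ABdRLNR §2): zeroing every variable that is not of the form `x_{i,e(u)}` and renaming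
`x_{i,e(u)} ↦ x_{i,u}` turns a regular refutation of `Clique(G,k)` into a regular refutation of
`Clique(G[e],k)` that is no longer. Stated over Boolean adjacency matrices. -/
def RestrictToInduced : Prop :=
  ∀ (n m k : ℕ) (adj : Fin n → Fin n → Bool) (e : Fin m ↪ Fin n) (π : List (ResLine ℕ)),
    IsResRefutation (cliqueCNF n k adj) π → IsRegular π →
    ∃ π' : List (ResLine ℕ), IsResRefutation (cliqueCNF m k fun u v => adj (e u) (e v)) π' ∧
      IsRegular π' ∧ π'.length ≤ π.length

/-- **Stub 3 — the sound-path bottleneck count** (ABdRLNR arXiv:2012.09476 Thm 6.4 / Claim 6.5 /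
Lemmas 6.6–6.7 re-run under the path distribution `D*`; the deterministic, conditional theorem of the
line). For a lower-bi-dense `H` whose sound traps are sparse at admissible parameters, every regular
refutation `π` of the unary `Clique(H,k)` satisfies the union-bound inequality
`1 ≤ |π|²·k·(p₁^{r/2} + τ + (1-p₁)^{q' - refCount·M})`
(pairs of lines × block index; Case 1, Case 2a = traps, Case 2b = `q'` zeros of which at most
`refCount k L₀ · M` are junk and the rest are coins). Side conditions: `t` pieces of `≤ b` acceptances
(`k ≤ t b`), reference sets up to size `L₀ ≥ t r`, goodness threshold `q` with `t q ≤ δ^{tr} m`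
(Lemma 6.6 from the soundness invariant `|N̂(R)| ≥ δ^{|R|} m`), and `M ≤ δ^{L₀} m` (reference sets
stay above the bi-density scale, so each has `< M` junk vertices). -/
def SoundPathCount : Prop :=
  ∀ (m k : ℕ) (H : SimpleGraph (Fin m)) [DecidableRel H.Adj] (δ : ℝ) (M L₀ r b t q q' : ℕ) (p₁ τ : ℝ),
    0 < δ → δ ≤ 1 → LowerBiDense H M δ →
    1 ≤ b → k ≤ t * b → t * r ≤ L₀ → 0 < q → (t : ℝ) * q ≤ δ ^ (t * r) * m → (M : ℝ) ≤ δ ^ L₀ * m →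
    0 ≤ p₁ → p₁ ≤ 1 →
    SoundTrapSparseAt H δ L₀ r b q q' (k * p₁) τ →
    ∀ π : List (ResLine ℕ), IsResRefutation (cliqueCNF m k fun u v => decide (H.Adj u v)) π →
      IsRegular π →
      (1 : ℝ) ≤ (π.length : ℝ) ^ 2 * (k * (p₁ ^ (r / 2) + τ + (1 - p₁) ^ (q' - refCount k L₀ * M)))

/-- **Stub 4 — bi-dense graphs are sound-trap sparse (THE BET)**: for a two-sided bi-dense `H` and
`k ≤ C log₂ m` there is an admissible parameter choice (for `SoundPathCount`) at which the sound
traps are sparse enough that the union-bound quantity is `≤ m^{-2ε log₂ m}`. Contains the card's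
`SoundTrapWeight` (the only use of UPPER density) together with the parameter regime. -/
def BiDenseTrapSparse : Prop :=
  ∀ (β δ C : ℝ), 0 < β → β < 1 → 0 < δ → δ < 1 → 0 < C →
    ∃ ε : ℝ, 0 < ε ∧ ∃ m₀ : ℕ, ∀ m ≥ m₀, ∀ k : ℕ, (k : ℝ) ≤ C * Real.logb 2 m →
      ∀ (H : SimpleGraph (Fin m)) [DecidableRel H.Adj],
        LowerBiDense H ⌈(m : ℝ) ^ (1 - β)⌉₊ δ → UpperBiDense H ⌈(m : ℝ) ^ (1 - β)⌉₊ δ →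
        ∃ (L₀ r b t q q' : ℕ) (p₁ τ : ℝ),
          (1 ≤ b ∧ k ≤ t * b ∧ t * r ≤ L₀ ∧ 0 < q ∧ (t : ℝ) * q ≤ δ ^ (t * r) * m ∧
            (⌈(m : ℝ) ^ (1 - β)⌉₊ : ℝ) ≤ δ ^ L₀ * m ∧ 0 ≤ p₁ ∧ p₁ ≤ 1) ∧
          SoundTrapSparseAt H δ L₀ r b q q' (k * p₁) τ ∧
          (m : ℝ) ^ (2 * ε * Real.logb 2 m) *
              (k * (p₁ ^ (r / 2) + τ + (1 - p₁) ^ (q' - refCount k L₀ * ⌈(m : ℝ) ^ (1 - β)⌉₊))) ≤ 1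

/-- **The transfer target `C⁺`** (NOT a stub — proved below from stubs 3 + 4): two-sided bi-dense
graphs need regular refutations of length `m^{ε log₂ m}` for `Clique(H,k)`, `k ≤ C log₂ m`
(ABdRLNR §9's "deterministic pseudo-random" question with bi-density as the hypothesis). -/
def BiDenseRegularLB : Prop :=
  ∀ (β δ C : ℝ), 0 < β → β < 1 → 0 < δ → δ < 1 → 0 < C →
    ∃ ε : ℝ, 0 < ε ∧ ∃ m₀ : ℕ, ∀ m ≥ m₀, ∀ k : ℕ, (k : ℝ) ≤ C * Real.logb 2 m →
      ∀ (H : SimpleGraph (Fin m)) [DecidableRel H.Adj],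
        LowerBiDense H ⌈(m : ℝ) ^ (1 - β)⌉₊ δ → UpperBiDense H ⌈(m : ℝ) ^ (1 - β)⌉₊ δ →
        ∀ π : List (ResLine ℕ), IsResRefutation (cliqueCNF m k fun u v => decide (H.Adj u v)) π →
          IsRegular π → (m : ℝ) ^ (ε * Real.logb 2 m) ≤ (π.length : ℝ)

/-! ## §2 Registered stubs

Every stub is stated with its statement WRITTEN OUT over the landed vocabulary
(`Theorems/RamseyUncertifiableRegularResolutionRungDefs.lean`, same namespace), so that a worker's
`theorem stub_x : <signature>` in a `Theorems/` file matches the registered signature verbatim; the named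
`Prop`s of §1 are definitionally these statements and are used only by the glue. -/

/-- **stub_erdosSzemeredi** (size M; KNOWN theorem: Erdős–Szemerédi 1972, via the exchange/pigeonhole
proof: `L` = the `≥ n/2` vertices of degree `≤ 2·density·n`, `I` a maximum independent set of `G[L]`,
`α := |I| < k`; for `v ∈ L ∖ I` the pattern `N(v) ∩ I` is non-empty (maximality) and has size `≤ s := 8εα`
for at least half of them (`Σ_v |N(v) ∩ I| ≤ Σ_{u ∈ I} deg u ≤ 2ε n α`); pigeonhole over the
`≤ Σ_{j ≤ s} C(α, j) ≤ (eα/s)^s` patterns gives a class `X_P` of `≥ (n/4)(eα/s)^{-s}` vertices with the same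
pattern `P`; an independent `J ⊆ X_P` makes `(I ∖ P) ∪ J` independent in `G[L]`, so `α(G[X_P]) ≤ |P| ≤ s`;
Erdős–Szekeres (tree: `exists_clique_or_indep_of_choose_le_card`) bounds `|X_P| < C(k + s, s)`; hence
`log₂ n ≤ 2 + s·log₂(e/(8ε)) + s·log₂(e(k+s)/s)`, impossible for `k ≤ C log₂ n` once
`16 C ε log₂(e/(4ε)) < 1` and `n` is large). Statement = `ErdosSzemerediLower`. -/
theorem stub_erdosSzemeredi :
    ∀ C : ℝ, 0 < C → ∃ ε : ℝ, 0 < ε ∧ ∃ n₀ : ℕ, ∀ n ≥ n₀,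
      ∀ (G : SimpleGraph (Fin n)) [DecidableRel G.Adj] (k : ℕ), (k : ℝ) ≤ C * Real.logb 2 n →
        G.CliqueFree k → Gᶜ.CliqueFree k → ε * n * n ≤ (edgeCount G Finset.univ Finset.univ : ℝ) := by
  sorry

/-- **stub_ramseyBiDenseCore** (size L; KNOWN theorem: Prömel–Rödl 1999 = LPRT13 Lemma 11, derived here
from Erdős–Szemerédi by the K-step pair extraction of Bukh–Sudakov / Kwan–Sudakov arXiv:1711.02937 Lemma 4
run at polynomial scale: if `U` (`|U| ≥ n^{3/4}`) is not two-sided bi-dense at scale `⌈|U|^{1-β}⌉`, a bad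
pair `(A,B)` (made disjoint at a quarter of the size) gives `S_i ⊆ {a ∈ A : d(a,B) < 2δ}` of a fixed size
`s` and `U_i := {b ∈ B : d(b,S_i) < 4δ}`, `|U_i| ≥ |B|/2` (Markov), so every LATER `S_j ⊆ U_i` has
`d(S_j, S_i) < 4δ` (dense case: `> 1 - 4δ`); after `K` steps half the `S_i` have the same type and their
union `S` (`|S| ≥ s ≥ n^{1/2}/4`, `k ≤ 5 log₂ |S|`) has `d(S) < 1/⌊K/2⌋ + 4δ < ε_ES(5)` (or the complementary
bound), contradicting stub 1a applied to `G[S]` (resp. `Gᶜ[S]`, via `Finset.orderEmbOfFin`); constants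
`K := ⌈2/ε⌉+1`, `δ := ε/8`, `β := 1/(5(K+1))` so `(1-β)^{K+1} ≥ 4/5 > 3/4`). Statement =
`ErdosSzemerediLower → RamseyBiDenseCore`. -/
theorem stub_ramseyBiDenseCore :
    (∀ C : ℝ, 0 < C → ∃ ε : ℝ, 0 < ε ∧ ∃ n₀ : ℕ, ∀ n ≥ n₀,
      ∀ (G : SimpleGraph (Fin n)) [DecidableRel G.Adj] (k : ℕ), (k : ℝ) ≤ C * Real.logb 2 n →
        G.CliqueFree k → Gᶜ.CliqueFree k → ε * n * n ≤ (edgeCount G Finset.univ Finset.univ : ℝ)) →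
    ∃ β : ℝ, 0 < β ∧ β < 1 ∧ ∃ δ : ℝ, 0 < δ ∧ δ < 1 ∧ ∃ n₀ : ℕ, ∀ n ≥ n₀,
      ∀ (G : SimpleGraph (Fin n)) [DecidableRel G.Adj],
        G.CliqueFree (Nat.clog 2 (n ^ 2)) → Gᶜ.CliqueFree (Nat.clog 2 (n ^ 2)) →
        ∃ m : ℕ, (n : ℝ) ^ (3 / 4 : ℝ) ≤ m ∧ ∃ e : Fin m ↪ Fin n,
          LowerBiDense (G.comap e) ⌈(m : ℝ) ^ (1 - β)⌉₊ δ ∧ UpperBiDense (G.comap e) ⌈(m : ℝ) ^ (1 - β)⌉₊ δ := by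
  sorry

/-- **stub_restrictToInduced** (size M; folklore): restrict by the partial assignment that zeroes
every variable not of the form `i·n + e(u)` (`i < k`, `u < m`) — this also removes junk variables
introduced by weakening — then rename `i·n + e(u) ↦ i·m + u` (injective on the surviving variables).
Block clauses restrict to block clauses (the empty clause when `m = 0`), the 2-clauses restrict to
the 2-clauses of `Clique(G[e],k)` (as finsets) or become satisfied and disappear; COPY the line map of the
tree's `IsResRefutation.exists_map_restrict` (ResolutionRestrictionMap.lean: satisfied line ↦ junk axiom,
resolution on a zeroed pivot ↦ weakening of one premise, indices kept) and ADD regularity: premise lists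
only shrink, so every DAG path of `π'` is a DAG path of `π` and its pivots are the injective image of a
sub-list of the pivots of `π` along the same path (`List.Sublist.nodup`, `List.Nodup.map`). `k = 0` is
vacuous (no clauses, no refutation); `n = 0` forces `m = 0`. Statement = `RestrictToInduced`. -/
theorem stub_restrictToInduced :
    ∀ (n m k : ℕ) (adj : Fin n → Fin n → Bool) (e : Fin m ↪ Fin n) (π : List (ResLine ℕ)),
      IsResRefutation (cliqueCNF n k adj) π → IsRegular π →
      ∃ π' : List (ResLine ℕ), IsResRefutation (cliqueCNF m k fun u v => adj (e u) (e v)) π' ∧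
        IsRegular π' ∧ π'.length ≤ π.length := by
  sorry

/-- **stub_soundPathCount** (size XL; the conditional theorem — ABdRLNR §6 with three changes).
Path process `D*` on the refutation DAG from the empty clause (pre-sample one `p₁`-coin per
variable `x_{i,v}`, `i < k`, `v < m`; a pivot outside this range is answered `0` without a coin): at a
resolution line with pivot `x_{i,v}` answer `0` if (F0) block `i` already has an accepted vertex on this
path, (F1) some 2-clause `{¬x_{i,v}, ¬y}` of the formula has `(y,false)` in the current clause, (F2) `v` is
junk: `|N̂(U' ∪ {v})| < δ|N̂(U')|` for some `U' ⊆ ACC`, `|U'| ≤ L₀`; otherwise use the coin (answer `1` =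
"accept `v`"); at a weakening line pass to the premise; the invariant "the current clause is falsified by
the answers so far" holds by construction and regularity makes the answers a partial assignment. Then:
leaves are block axioms `⋁_v x_{i*,v}` (an edge/functionality axiom `{¬x, ¬y}` at the leaf would need both
pivots answered `1`; the later one was answered while `(other, false)` sat in the current clause —
indelibility of literals present at the end of a path under regularity — so F1 fired), with no block-`i*`
acceptance; `V⁰_{i*}(c)`/`V¹(c)` := positive block-`i*` / negative literals of the clause at `c`;
Lemma 6.6' (`commonNbhd_chain_lb`, `t·q ≤ δ^{tr} m`, `t r ≤ L₀`, pieces of `≤ b` acceptances, `k ≤ t b`):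
some piece `W = V⁰_{i*}(b) ∖ V⁰_{i*}(a)` is `(r,q)`-dense for every `≤ r`-subset of ACC; Lemma 6.7' with
`T := V¹(a)`, `R(α)` := acceptances between `a` and `b`: Case 1 (`|T| > r/2`) `p₁^{⌊r/2⌋+1}` (fixed
coins); Case 2b: the `≥ q'` zeros on `W ∩ N̂(R(α) ∪ T)` were answered between `a` and `b` (monotonicity),
are coins except `< refCount k L₀ · M` junk ones (`junk_card_lt`, reference sets have `≥ δ^{L₀} m ≥ M`
common neighbours) ⇒ `(1-p₁)^{q' - refCount·M}` by the adaptive-read lemma (first `N` reads of independent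
coins inside a fixed set all `0`); Case 2a: a minimal `B ⊆ R(α) ∖ T` closing the trap is an
`IsTrap … W T B` (density w.r.t. subsets of ACC, soundness hereditary) and `P[B ⊆ ACC] ≤ (k p₁)^{|B|}` ⇒
`≤ trapWeight ≤ τ`; union over `|π|²` pairs × `k` blocks `i*`. Degenerate corners (`k = 0`, `t = 0`,
`q' ≤ refCount·M`, `p₁ ∈ {0,1}`, `r ≤ 1`) make the inequality trivial. Leans on: tree Resolution.lean
decls; finite sums over coin vectors `Fin (k*m) → Bool` weighted `p₁^{#1}(1-p₁)^{#0}` (no measure theory).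
Statement = `SoundPathCount`. -/
theorem stub_soundPathCount :
    ∀ (m k : ℕ) (H : SimpleGraph (Fin m)) [DecidableRel H.Adj] (δ : ℝ) (M L₀ r b t q q' : ℕ) (p₁ τ : ℝ),
      0 < δ → δ ≤ 1 → LowerBiDense H M δ →
      1 ≤ b → k ≤ t * b → t * r ≤ L₀ → 0 < q → (t : ℝ) * q ≤ δ ^ (t * r) * m → (M : ℝ) ≤ δ ^ L₀ * m →
      0 ≤ p₁ → p₁ ≤ 1 →
      SoundTrapSparseAt H δ L₀ r b q q' (k * p₁) τ →
      ∀ π : List (ResLine ℕ), IsResRefutation (cliqueCNF m k fun u v => decide (H.Adj u v)) π →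
        IsRegular π →
        (1 : ℝ) ≤ (π.length : ℝ) ^ 2 * (k * (p₁ ^ (r / 2) + τ + (1 - p₁) ^ (q' - refCount k L₀ * M))) := by
  sorry

/-- **stub_biDenseTrapSparse** (THE BET; HARDEST — open combinatorics; held by the lead). For a
two-sided bi-dense `H` and `k ≤ C log₂ m` there is an admissible parameter choice (for `SoundPathCount`)
at which the sound traps are sparse enough that the union-bound quantity is `≤ m^{-2ε log₂ m}`.
Forced features of any admissible point (lead's analysis, NOTES ## Census): `q' ≤ q` (else `B = ∅` traps of
weight 1), `r ≥ 2`, `p₁ ≥ 2ε log² m / q'`, and for `k > L₀/2` traps of size `> r - |T|` fit (`b > r/2`);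
generic `G(m,½)`-type traps force `q' ≤ q·2^{-(r/2+1+o(r))}`, still admissible. Statement =
`BiDenseTrapSparse`. -/
theorem stub_biDenseTrapSparse :
    ∀ (β δ C : ℝ), 0 < β → β < 1 → 0 < δ → δ < 1 → 0 < C →
      ∃ ε : ℝ, 0 < ε ∧ ∃ m₀ : ℕ, ∀ m ≥ m₀, ∀ k : ℕ, (k : ℝ) ≤ C * Real.logb 2 m →
        ∀ (H : SimpleGraph (Fin m)) [DecidableRel H.Adj],
          LowerBiDense H ⌈(m : ℝ) ^ (1 - β)⌉₊ δ → UpperBiDense H ⌈(m : ℝ) ^ (1 - β)⌉₊ δ →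
          ∃ (L₀ r b t q q' : ℕ) (p₁ τ : ℝ),
            (1 ≤ b ∧ k ≤ t * b ∧ t * r ≤ L₀ ∧ 0 < q ∧ (t : ℝ) * q ≤ δ ^ (t * r) * m ∧
              (⌈(m : ℝ) ^ (1 - β)⌉₊ : ℝ) ≤ δ ^ L₀ * m ∧ 0 ≤ p₁ ∧ p₁ ≤ 1) ∧
            SoundTrapSparseAt H δ L₀ r b q q' (k * p₁) τ ∧
            (m : ℝ) ^ (2 * ε * Real.logb 2 m) *
                (k * (p₁ ^ (r / 2) + τ + (1 - p₁) ^ (q' - refCount k L₀ * ⌈(m : ℝ) ^ (1 - β)⌉₊))) ≤ 1 := by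
  sorry

/-! ## §3 Proved glue -/

/-- `C⁺` from stubs 3 and 4: plug the parameters of stub 4 into stub 3, then
`1 ≤ |π|²·X` and `m^{2ε log₂ m}·X ≤ 1` give `m^{ε log₂ m} ≤ |π|`. -/
theorem biDenseRegularLB_of (h₃ : SoundPathCount) (h₄ : BiDenseTrapSparse) : BiDenseRegularLB := by
  intro β δ C hβ hβ1 hδ hδ1 hC
  obtain ⟨ε, hε, m₀, hm⟩ := h₄ β δ C hβ hβ1 hδ hδ1 hC
  refine ⟨ε, hε, m₀, fun m hmm k hk H _ hlo hup π hπ hreg => ?_⟩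
  obtain ⟨L₀, r, b, t, q, q', p₁, τ, ⟨hb, htb, hL, hq, htq, hM, hp0, hp1⟩, hsparse, hfinal⟩ :=
    hm m hmm k hk H hlo hup
  have hcount := h₃ m k H δ ⌈(m : ℝ) ^ (1 - β)⌉₊ L₀ r b t q q' p₁ τ hδ hδ1.le hlo hb htb hL hq htq hM
    hp0 hp1 hsparse π hπ hreg
  set X : ℝ := (k : ℝ) * (p₁ ^ (r / 2) + τ + (1 - p₁) ^ (q' - refCount k L₀ * ⌈(m : ℝ) ^ (1 - β)⌉₊))
    with hX
  set L : ℝ := (π.length : ℝ) with hLdef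
  have hA : 0 ≤ (m : ℝ) ^ (2 * ε * Real.logb 2 m) := Real.rpow_nonneg (Nat.cast_nonneg _) _
  have h1 : (m : ℝ) ^ (2 * ε * Real.logb 2 m) ≤ L ^ 2 := by
    calc (m : ℝ) ^ (2 * ε * Real.logb 2 m) ≤ (m : ℝ) ^ (2 * ε * Real.logb 2 m) * (L ^ 2 * X) :=
          le_mul_of_one_le_right hA hcount
      _ = L ^ 2 * ((m : ℝ) ^ (2 * ε * Real.logb 2 m) * X) := by ring
      _ ≤ L ^ 2 * 1 := mul_le_mul_of_nonneg_left hfinal (sq_nonneg _)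
      _ = L ^ 2 := mul_one _
  have h2 : ((m : ℝ) ^ (ε * Real.logb 2 m)) ^ 2 = (m : ℝ) ^ (2 * ε * Real.logb 2 m) := by
    rw [← Real.rpow_natCast, ← Real.rpow_mul (Nat.cast_nonneg _)]
    congr 1
    push_cast
    ring
  have hL0 : 0 ≤ L := Nat.cast_nonneg _
  have h3 : ((m : ℝ) ^ (ε * Real.logb 2 m)) ^ 2 ≤ L ^ 2 := h2 ▸ h1
  exact (pow_le_pow_iff_left₀ (Real.rpow_nonneg (Nat.cast_nonneg _) _) hL0 two_ne_zero).1 h3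

/-- Soundness of resolution, line by line: under a satisfying assignment every derived clause
contains a true literal. -/
theorem exists_true_literal_of_derivation {φ : CNF ℕ} {π : List (ResLine ℕ)}
    (hπ : IsResDerivation φ π) (σ : ℕ → Bool) (hσ : φ.eval σ = true) :
    ∀ a (ha : a < π.length), ∃ l ∈ (π[a]).clause, Literal.eval σ l = true := by
  intro a
  induction a using Nat.strong_induction_on with
  | _ a ih =>
    intro ha
    have hv := hπ a ha
    unfold IsValidResLine at hv
    split at hv
    · next heq =>
      obtain ⟨c, hc, hce⟩ := List.mem_map.1 hv
      have hct : c.any (Literal.eval σ) = true := by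
        have := (CNF.eval_eq_true_iff φ σ).1 hσ c hc
        simpa [Clause.eval] using this
      obtain ⟨l, hl, hle⟩ := List.any_eq_true.1 hct
      exact ⟨l, hce ▸ List.mem_toFinset.2 hl, hle⟩
    · next i j v heq =>
      obtain ⟨hi, hj, hres⟩ := hv
      have hi' : i < a ∧ i < π.length := by simpa [List.length_take] using hi
      have hj' : j < a ∧ j < π.length := by simpa [List.length_take] using hj
      obtain ⟨hvC, hvD, hE⟩ := hres
      simp only [List.getElem_take] at hvC hvD hE
      obtain ⟨l₁, hl₁, e₁⟩ := ih i hi'.1 hi'.2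
      obtain ⟨l₂, hl₂, e₂⟩ := ih j hj'.1 hj'.2
      cases hσv : σ v
      · refine ⟨l₁, ?_, e₁⟩
        rw [hE]
        refine Finset.mem_union_left _ (Finset.mem_erase.2 ⟨?_, hl₁⟩)
        rintro rfl
        simp [Literal.eval, hσv] at e₁
      · refine ⟨l₂, ?_, e₂⟩
        rw [hE]
        refine Finset.mem_union_right _ (Finset.mem_erase.2 ⟨?_, hl₂⟩)
        rintro rfl
        simp [Literal.eval, hσv] at e₂
    · next i heq =>
      obtain ⟨hi, hsub⟩ := hv
      have hi' : i < a ∧ i < π.length := by simpa [List.length_take] using hi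
      simp only [List.getElem_take] at hsub
      obtain ⟨l, hl, e⟩ := ih i hi'.1 hi'.2
      exact ⟨l, hsub hl, e⟩

/-- Soundness of resolution: a refuted CNF is unsatisfiable (the tree states this as the named
fact `not_satisfiable_of_isResRefutation`; proved here for `ν = ℕ`). -/
theorem not_satisfiable_of_refutation {φ : CNF ℕ} {π : List (ResLine ℕ)}
    (h : IsResRefutation φ π) : ¬ φ.Satisfiable := by
  rintro ⟨σ, hσ⟩
  obtain ⟨hd, l, hl, hle⟩ := h
  obtain ⟨a, ha, rfl⟩ := List.mem_iff_getElem.1 hl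
  obtain ⟨x, hx, -⟩ := exists_true_literal_of_derivation hd σ hσ a ha
  rw [hle] at hx
  simp at hx

/-- Faithfulness of the encoding (easy direction): a `k`-clique `f` satisfies `Clique(G,k)`
(assignment `x_{i,v} := [v = f i]`; the `u = v` edge axioms are handled by injectivity). -/
theorem satisfiable_cliqueCNF_of_clique {n k : ℕ} (adj : Fin n → Fin n → Bool) (f : Fin k → Fin n)
    (hf : Function.Injective f) (hadj : ∀ i j, i ≠ j → adj (f i) (f j) = true) :
    (cliqueCNF n k adj).Satisfiable := by
  classical
  let S : Finset ℕ := Finset.univ.image fun i : Fin k => (i : ℕ) * n + (f i : ℕ)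
  have key : ∀ (i : ℕ) (v : Fin n), i * n + (v : ℕ) ∈ S → ∃ hi : i < k, f ⟨i, hi⟩ = v := by
    intro i v hv
    obtain ⟨i', -, hi'⟩ := Finset.mem_image.1 hv
    have h1 := digits_of (s := (i' : ℕ)) (f i').isLt
    have h2 := digits_of (s := i) v.isLt
    rw [hi'] at h1
    have hii : (i' : ℕ) = i := h1.1.symm.trans h2.1
    have hfv : ((f i' : ℕ)) = v := h1.2.symm.trans h2.2
    refine ⟨hii ▸ i'.isLt, ?_⟩
    have : (⟨i, hii ▸ i'.isLt⟩ : Fin k) = i' := Fin.ext hii.symm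
    rw [this]
    exact Fin.ext hfv
  refine ⟨fun x => decide (x ∈ S), ?_⟩
  rw [CNF.eval_eq_true_iff]
  intro c hc
  simp only [cliqueCNF, List.mem_append, List.mem_map, List.mem_flatMap, List.mem_range,
    List.mem_finRange, true_and, List.mem_ite_nil_right, List.mem_singleton] at hc
  rw [Clause.eval, List.any_eq_true]
  rcases hc with (⟨i, hi, rfl⟩ | ⟨i, hi, u, hu, v, hv, huv, rfl⟩) | ⟨i, hi, j, hj, u, v, ⟨hij, huv⟩, rfl⟩
  · -- block clause: the literal of `f i` is true
    refine ⟨((i * n + ((f ⟨i, hi⟩ : Fin n) : ℕ)), true), ?_, ?_⟩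
    · refine List.mem_map.2 ⟨((f ⟨i, hi⟩ : Fin n) : ℕ), ?_, rfl⟩
      simp
    · have : i * n + ((f ⟨i, hi⟩ : Fin n) : ℕ) ∈ S :=
        Finset.mem_image.2 ⟨⟨i, hi⟩, Finset.mem_univ _, rfl⟩
      simp [Literal.eval, this]
  · -- functionality clause (`u < v` range over the coerced vertex list)
    have hu' : ∃ a : Fin n, u = (a : ℕ) := by simpa using hu
    have hv' : ∃ a : Fin n, v = (a : ℕ) := by simpa using hv
    obtain ⟨u, rfl⟩ := hu'
    obtain ⟨v, rfl⟩ := hv'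
    by_cases hu : i * n + (u : ℕ) ∈ S
    · refine ⟨(i * n + (v : ℕ), false), by simp, ?_⟩
      have hv : i * n + (v : ℕ) ∉ S := by
        intro hv
        obtain ⟨_, e1⟩ := key i u hu
        obtain ⟨_, e2⟩ := key i v hv
        have : (u : ℕ) = v := by rw [← e1, ← e2]
        omega
      simp [Literal.eval, hv]
    · exact ⟨(i * n + (u : ℕ), false), by simp, by simp [Literal.eval, hu]⟩
  · -- edge clause
    by_cases hu : i * n + (u : ℕ) ∈ S
    · refine ⟨(j * n + (v : ℕ), false), by simp, ?_⟩
      have hv : j * n + (v : ℕ) ∉ S := by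
        intro hv
        obtain ⟨hi1, e1⟩ := key i u hu
        obtain ⟨hj1, e2⟩ := key j v hv
        have hne : (⟨i, hi1⟩ : Fin k) ≠ ⟨j, hj1⟩ := fun h => hij (by simpa using h)
        have := hadj _ _ hne
        rw [e1, e2] at this
        rw [this] at huv
        exact Bool.noConfusion huv
      simp [Literal.eval, hv]
    · exact ⟨(i * n + (u : ℕ), false), by simp, by simp [Literal.eval, hu]⟩

/-- Soundness + encoding: a refuted `Clique(G,k)` means `G` has no `k`-clique. Applied to `π₁` AND
to `π₂` below — the complement refutation is what certifies `α(G) < k` (Disproof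
`regularResolutionRung_false_without_complement`: without `π₂` the crux is false). -/
theorem cliqueFree_of_refutation {n k : ℕ} (G : SimpleGraph (Fin n)) [DecidableRel G.Adj]
    {π : List (ResLine ℕ)} (h : IsResRefutation (cliqueCNF n k fun u v => decide (G.Adj u v)) π) :
    G.CliqueFree k := by
  intro s hs
  apply not_satisfiable_of_refutation h
  have hcard : s.card = k := hs.card_eq
  let f : Fin k → Fin n := fun i => s.orderEmbOfFin hcard i
  refine satisfiable_cliqueCNF_of_clique _ f ?_ ?_
  · intro i j hij
    exact (s.orderEmbOfFin hcard).injective hij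
  · intro i j hij
    have hi : f i ∈ s := s.orderEmbOfFin_mem hcard i
    have hj : f j ∈ s := s.orderEmbOfFin_mem hcard j
    have hne : f i ≠ f j := fun h => hij ((s.orderEmbOfFin hcard).injective h)
    have := hs.isClique hi hj hne
    simpa using this

/-- Threshold arithmetic: `Nat.clog 2 (n²) ≤ 2·log₂ n + 2` for `n ≥ 2`. -/
theorem clog_sq_le (n : ℕ) (hn : 2 ≤ n) : (Nat.clog 2 (n ^ 2) : ℝ) ≤ 2 * Real.logb 2 n + 2 := by
  set c := Nat.clog 2 n with hc
  have h1 : Nat.clog 2 (n ^ 2) ≤ 2 * c := by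
    apply Nat.clog_le_of_le_pow
    have := Nat.le_pow_clog (by norm_num : 1 < 2) n
    calc n ^ 2 ≤ (2 ^ c) ^ 2 := Nat.pow_le_pow_left this 2
      _ = 2 ^ (2 * c) := by rw [← pow_mul, mul_comm]
  have hcpos : 0 < c := Nat.clog_pos (by norm_num) (by omega)
  have h2 : (2 : ℝ) ^ (c - 1) < n := by
    have := Nat.pow_pred_clog_lt_self (b := 2) (by norm_num) (by omega : 1 < n)
    rw [Nat.pred_eq_sub_one] at this
    exact_mod_cast this
  have h3 : ((c - 1 : ℕ) : ℝ) < Real.logb 2 n := by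
    have hlog := Real.logb_lt_logb (b := 2) (by norm_num) (by positivity) h2
    rwa [Real.logb_pow, Real.logb_self_eq_one (by norm_num), mul_one] at hlog
  have h4 : (c : ℝ) ≤ Real.logb 2 n + 1 := by
    have : ((c - 1 : ℕ) : ℝ) = (c : ℝ) - 1 := by
      rw [Nat.cast_sub (by omega)]
      simp
    linarith [this ▸ h3]
  calc (Nat.clog 2 (n ^ 2) : ℝ) ≤ ((2 * c : ℕ) : ℝ) := by exact_mod_cast h1
    _ = 2 * (c : ℝ) := by push_cast; ring
    _ ≤ 2 * Real.logb 2 n + 2 := by linarith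

/-- The transfer: Prömel–Rödl core + restriction + `C⁺` give the crux (in its definitional
`Restated` form). Only `π₁` is bounded; `π₂` enters through `cliqueFree_of_refutation` (Ramsey-ness
of `G` is needed to extract the core). Exponents: `m ≥ n^{3/4}` gives `(log₂ m)² ≥ (9/16)(log₂ n)²`,
and `k = ⌈2log₂ n⌉ ≤ 2log₂ n + 2 ≤ 4 log₂ m`. -/
theorem restated_of_transfer (h₁ : RamseyBiDenseCore) (h₂ : RestrictToInduced)
    (hC : BiDenseRegularLB) : Restated := by
  obtain ⟨β, hβ, hβ1, δ, hδ, hδ1, n₁, hcore⟩ := h₁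
  obtain ⟨ε₁, hε₁, m₀, hlb⟩ := hC β δ 4 hβ hβ1 hδ hδ1 (by norm_num)
  refine ⟨9 * ε₁ / 16, by positivity, max n₁ (max 8 (m₀ ^ 2)), ?_⟩
  intro n hn G _ π₁ π₂ hπ₁ hreg₁ hπ₂ hreg₂
  have hn₁ : n₁ ≤ n := le_trans (le_max_left _ _) hn
  have hn8 : 8 ≤ n := le_trans (le_trans (le_max_left _ _) (le_max_right _ _)) hn
  have hnm₀ : m₀ ^ 2 ≤ n := le_trans (le_trans (le_max_right _ _) (le_max_right _ _)) hn
  set k := Nat.clog 2 (n ^ 2) with hk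
  -- Ramsey-ness of G from BOTH refutations (soundness)
  have hGk : G.CliqueFree k := cliqueFree_of_refutation G hπ₁
  have hGck : Gᶜ.CliqueFree k := cliqueFree_of_refutation Gᶜ hπ₂
  -- the bi-dense core
  obtain ⟨m, hm34, e, hlo, hup⟩ := hcore n hn₁ G hGk hGck
  -- restrict π₁ to the core
  obtain ⟨π', hπ', hreg', hlen⟩ := h₂ n m k (fun u v => decide (G.Adj u v)) e π₁ hπ₁ hreg₁
  -- real-number bookkeeping
  have hn8R : (8 : ℝ) ≤ n := by exact_mod_cast hn8
  have hn1R : (1 : ℝ) ≤ n := by linarith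
  have hnpos : (0 : ℝ) < n := by linarith
  have hlogn3 : (3 : ℝ) ≤ Real.logb 2 n := by
    have h8 : Real.logb 2 (8 : ℝ) = 3 := by
      rw [show (8 : ℝ) = 2 ^ (3 : ℕ) by norm_num, Real.logb_pow, Real.logb_self_eq_one (by norm_num)]
      norm_num
    rw [← h8]
    exact Real.logb_le_logb_of_le (by norm_num) (by norm_num) hn8R
  have hm1R : (1 : ℝ) ≤ m := le_trans (Real.one_le_rpow hn1R (by norm_num)) hm34
  have hmpos : (0 : ℝ) < m := by linarith
  have hlogm : 3 / 4 * Real.logb 2 n ≤ Real.logb 2 m := by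
    have := Real.logb_le_logb_of_le (b := 2) (by norm_num) (Real.rpow_pos_of_pos hnpos _) hm34
    rwa [Real.logb_rpow_eq_mul_logb_of_pos hnpos] at this
  -- m ≥ m₀
  have hmm₀ : m₀ ≤ m := by
    have h1 : (m₀ : ℝ) ≤ Real.sqrt n := by
      rw [show (m₀ : ℝ) = Real.sqrt ((m₀ : ℝ) ^ 2) by rw [Real.sqrt_sq (Nat.cast_nonneg _)]]
      exact Real.sqrt_le_sqrt (by exact_mod_cast hnm₀)
    have h2 : Real.sqrt n ≤ (n : ℝ) ^ (3 / 4 : ℝ) := by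
      rw [Real.sqrt_eq_rpow]
      exact Real.rpow_le_rpow_of_exponent_le hn1R (by norm_num)
    exact_mod_cast h1.trans (h2.trans hm34)
  -- k ≤ 4 log₂ m
  have hk4 : (k : ℝ) ≤ 4 * Real.logb 2 m := by
    have := clog_sq_le n (by omega)
    rw [← hk] at this
    linarith
  -- apply C⁺ on the core H = G.comap e
  have hbound := hlb m hmm₀ k hk4 (G.comap e) hlo hup π' hπ' hreg'
  -- exponent comparison
  have hexp : (n : ℝ) ^ (9 * ε₁ / 16 * Real.logb 2 n) ≤ (m : ℝ) ^ (ε₁ * Real.logb 2 m) := by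
    have en : (n : ℝ) ^ (9 * ε₁ / 16 * Real.logb 2 n) =
        (2 : ℝ) ^ (Real.logb 2 n * (9 * ε₁ / 16 * Real.logb 2 n)) := by
      rw [Real.rpow_mul (by norm_num : (0 : ℝ) ≤ 2), Real.rpow_logb two_pos (by norm_num) hnpos]
    have em : (m : ℝ) ^ (ε₁ * Real.logb 2 m) =
        (2 : ℝ) ^ (Real.logb 2 m * (ε₁ * Real.logb 2 m)) := by
      rw [Real.rpow_mul (by norm_num : (0 : ℝ) ≤ 2), Real.rpow_logb two_pos (by norm_num) hmpos]
    rw [en, em]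
    apply Real.rpow_le_rpow_of_exponent_le (by norm_num : (1 : ℝ) ≤ 2)
    have h0 : 0 ≤ Real.logb 2 n := by linarith
    nlinarith [mul_le_mul hlogm hlogm (by positivity) (by linarith), hε₁.le]
  calc (n : ℝ) ^ (9 * ε₁ / 16 * Real.logb 2 n) ≤ (m : ℝ) ^ (ε₁ * Real.logb 2 m) := hexp
    _ ≤ (π'.length : ℝ) := hbound
    _ ≤ (π₁.length : ℝ) := by exact_mod_cast hlen
    _ ≤ max (π₁.length : ℝ) (π₂.length : ℝ) := le_max_left _ _

/-! ## §4 Kernel-checked composition: the stubs prove the crux BY NAME -/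

/-- The four stub STATEMENTS imply the crux (in its definitional `Restated` form): sorry-free,
axioms `propext`, `Classical.choice`, `Quot.sound`. -/
theorem restated_of_line (h₁ : RamseyBiDenseCore) (h₂ : RestrictToInduced) (h₃ : SoundPathCount)
    (h₄ : BiDenseTrapSparse) : Restated :=
  restated_of_transfer h₁ h₂ (biDenseRegularLB_of h₃ h₄)

/-- **The line closes the crux BY NAME**: `stub_erdosSzemeredi → stub_ramseyBiDenseCore → stub_restrictToInduced →
stub_soundPathCount → stub_biDenseTrapSparse → RegularResolutionRung`, fed with the registered stubs
(the only `sorry`s of the file); `regularResolutionRung_iff_restated` is `Iff.rfl`. -/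
theorem RegularResolutionRung_of :
    Summit.PneNP.PneNP.Theses.RamseyUncertifiable.RegularResolutionRung :=
  regularResolutionRung_iff_restated.2
    (restated_of_line (stub_ramseyBiDenseCore stub_erdosSzemeredi) stub_restrictToInduced
      stub_soundPathCount stub_biDenseTrapSparse)

end Summit.PneNP.PneNP.Cruxes.RegularResolutionRung.SoundPathBottleneck
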